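import Mathlib
import Summits.Ventures.HodgeRepro2.T5DatumAssembly
import Summits.Ventures.HodgeRepro2.T6N2Datum
import Summits.Ventures.HodgeRepro2.T6N2Hyp

/-!
# T6N2Main — sub-step N2 in kernel: `Adm` for the explicit datum (owner t6-p5, re-pointed l. 5070 (1))

LEMMA N.2 of the record (TIER5 §N2.1(b), rows N2.2.6 / N2.2.8 / N2.2.9 / N2.2.10) on the datum type
`N2Datum` (T6N2Datum): given a CM frame `τ`, μ-admissible `e₁₁₁`, `e₁₀₀` and a similitude scalar
`u` with the sign specification `(+, −, +)` (`USpec`, the form p3's `lemma_N2_datum` delivers), the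
datum satisfies **`Adm`** — (b1) the four `e_i` are μ-admissible (`muAdmissible_of`: p3's
`isLiuSignElement_mul_of_sign` with the cube-type combinatorics `not_agree_datum_iff` /
`sameFlip_datum`); (b2) `W_B ≅ W_A` (`isIsometric_of`: dividing both skew-hermitian forms by `e₁₁₁`
gives the hermitian forms `⟨1, r⟩` and `⟨u, u⁻¹ r⟩`, `r = e₁₀₀ / e₁₁₁`, with the same determinant `r`
and the same index at every embedding — the latter because `u` is negative exactly where `r` is —
so the ONE display `Hyp.Shimura2008_Thm2_2_i` (Landherr's classification) gives the isometry, which is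
also an isometry of the skew-hermitian forms); (b3) (H_χ) (`hChi`: `rfl`, the characters of the
second pair are those of the first by construction). `adm_of` packages the three; `ofSpec` /
`ofSpec_adm` is the EXISTENCE form («the explicit datum meets it»: `u` chosen by p3's
`lemma_N2_datum`), with the display as the only non-kernel input. The composition wrapper over the
lead's `NAut2` (`N2_main … : M.AdmDatum`) is T6N2Contract.

README §8(d): uses an L-value-free non-vanishing device: NO (TIER5 §N2, a pre-02:16Z line of
record — N2 asserts no non-vanishing — continued).
-/

namespace Summit.Ventures.HodgeRepro2.T6.N2Main

open Summit.Ventures.HodgeRepro2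
open Summit.Ventures.HodgeRepro2.T5DatumSimilitude
open Summit.Ventures.HodgeRepro2.T5CubeTypes
open Summit.Ventures.HodgeRepro2.T5DatumCMField hiding star_inv_of_star_eq
open NumberField.ComplexEmbedding (conjugate)

variable {K : Type*} [Field K] [NumberField K] [NumberField.IsCMField K]
variable {F : FaceSetting K} {P : NDatum F} {𝒟 : N3Datum}

/-- The sign specification of the similitude scalar (§N2.1(b): `u ∈ F⁺`, signs `(+, −, +)` at
`(ι₁, ι₂, ι₃)` — negative exactly at the embeddings above the second real place), in the form p3's
`lemma_N2_datum` delivers it. -/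
def USpec (D : N2Datum F P 𝒟) : Prop :=
  star D.u = D.u ∧ D.u ≠ 0 ∧ ∀ φ : K →+* ℂ, (φ D.u).re < 0 ↔ φ = D.τ 1 ∨ φ = conjugate (D.τ 1)

/-! ### Elementary facts -/

/-- Scaling both coefficients of a diagonal form scales the form. -/
theorem pairForm_mul_left {E : Type*} [Field E] [StarRing E] (a c₁ c₂ : E) (v w : E × E) :
    pairForm (a * c₁) (a * c₂) v w = a * pairForm c₁ c₂ v w := by
  simp only [pairForm, lineForm]
  ring

/-- A sign element has purely imaginary image under every embedding. -/
theorem re_eq_zero_of_star_eq_neg {e : K} (he : star e = -e) (φ : K →+* ℂ) : (φ e).re = 0 := by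
  have h := embedding_star φ e
  rw [he, map_neg] at h
  have h2 := congrArg Complex.re h
  simp only [Complex.neg_re, Complex.conj_re] at h2
  linarith

/-- For a totally real `u`, `0 < Re φ(u)` iff `u` is not negative at `φ` (the real value is
non-zero). -/
theorem pos_re_iff_not_neg {u : K} (hu : star u = u) (hu0 : u ≠ 0) (φ : K →+* ℂ) :
    0 < (φ u).re ↔ ¬ (φ u).re < 0 := by
  have hne := re_ne_zero_of_star_eq hu hu0 φ
  constructor
  · intro h; exact not_lt.mpr h.le
  · intro h; exact lt_of_le_of_ne (not_lt.mp h) (Ne.symm hne)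

/-- The product of the images of two totally real elements has real part the product of the real
parts. -/
theorem re_mul_of_star_eq {u r : K} (hu : star u = u) (hr : star r = r) (φ : K →+* ℂ) :
    (φ (u * r)).re = (φ u).re * (φ r).re := by
  rw [map_mul, Complex.mul_re, im_eq_zero_of_star_eq hu φ, im_eq_zero_of_star_eq hr φ]
  ring

/-! ### (b1) μ-admissibility of the four sign elements -/

/-- `e₁₀₁ = u · e₁₁₁` is μ-admissible for the vertex type `101` (row N2.2.8). -/
theorem isLiuSignElement_e₁₀₁ (D : N2Datum F P 𝒟) (hfr : IsCMFrame D.τ)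
    (h₁₁₁ : IsLiuSignElement K (D.type t111) D.e₁₁₁) (hu : USpec D) :
    IsLiuSignElement K (D.type t101) D.e₁₀₁ := by
  refine isLiuSignElement_mul_of_sign (isCMType_cubeType hfr t111) h₁₁₁ hu.1 hu.2.1 fun φ => ?_
  rw [pos_re_iff_not_neg hu.1 hu.2.1 φ, hu.2.2 φ, ← not_agree_datum_iff hfr φ, not_not]
  exact Iff.rfl

/-- `e₁₁₀ = u⁻¹ · e₁₀₀` is μ-admissible for the vertex type `110` (row N2.2.8). -/
theorem isLiuSignElement_e₁₁₀ (D : N2Datum F P 𝒟) (hfr : IsCMFrame D.τ)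
    (h₁₀₀ : IsLiuSignElement K (D.type t100) D.e₁₀₀) (hu : USpec D) :
    IsLiuSignElement K (D.type t110) D.e₁₁₀ := by
  refine isLiuSignElement_mul_of_sign (isCMType_cubeType hfr t100) h₁₀₀ (T5DatumCMField.star_inv_of_star_eq hu.1)
    (inv_ne_zero hu.2.1) fun φ => ?_
  rw [pos_re_inv_iff hu.1 hu.2.1 φ, pos_re_iff_not_neg hu.1 hu.2.1 φ, hu.2.2 φ,
    ← not_agree_datum_iff hfr φ, not_not]
  exact sameFlip_datum hfr φ

/-- (b1): the four `ε_i` are μ-admissible (Liu Def. 4.12) for their vertex types. -/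
theorem muAdmissible_of (D : N2Datum F P 𝒟) (hfr : IsCMFrame D.τ)
    (h₁₁₁ : IsLiuSignElement K (D.type t111) D.e₁₁₁)
    (h₁₀₀ : IsLiuSignElement K (D.type t100) D.e₁₀₀) (hu : USpec D) : D.MuAdmissible :=
  ⟨hfr, h₁₁₁, h₁₀₀, isLiuSignElement_e₁₀₁ D hfr h₁₁₁ hu, isLiuSignElement_e₁₁₀ D hfr h₁₀₀ hu⟩

/-! ### (b3) (H_χ) -/

omit [NumberField.IsCMField K] in
/-- (b3): the hypothesis (H_χ) holds by construction (`χ₁₀₁ := χ₁₁₁`, `χ₁₁₀ := χ₁₀₀`). -/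
theorem hChi (D : N2Datum F P 𝒟) : D.HChi := rfl

/-! ### (b2) the isometry `W_B ≅ W_A` -/

/-- The hermitian coefficient `r = e₁₀₀ / e₁₁₁` of `W_A / e₁₁₁ = ⟨1, r⟩`. -/
noncomputable def rCoeff (D : N2Datum F P 𝒟) : K := D.e₁₀₀ * D.e₁₁₁⁻¹

/-- `r` is totally real. -/
theorem star_rCoeff (D : N2Datum F P 𝒟) (h₁₁₁ : star D.e₁₁₁ = -D.e₁₁₁)
    (h₁₀₀ : star D.e₁₀₀ = -D.e₁₀₀) : star (rCoeff D) = rCoeff D := by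
  rw [rCoeff, star_mul, star_inv₀, h₁₁₁, h₁₀₀, inv_neg]
  ring

/-- `Im φ(e₁₀₀) = Re φ(r) · Im φ(e₁₁₁)` at every embedding. -/
theorem im_e₁₀₀_eq (D : N2Datum F P 𝒟) (h₁₁₁ : star D.e₁₁₁ = -D.e₁₁₁)
    (h₁₀₀ : star D.e₁₀₀ = -D.e₁₀₀) (hne : D.e₁₁₁ ≠ 0) (φ : K →+* ℂ) :
    (φ D.e₁₀₀).im = (φ (rCoeff D)).re * (φ D.e₁₁₁).im := by
  rw [← im_mul_of_star_eq (star_rCoeff D h₁₁₁ h₁₀₀) φ D.e₁₁₁]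
  congr 2
  simp only [rCoeff]
  field_simp

/-- At the two embeddings above the second real place (`τ₂`, `τ̄₂`), `r` is negative: there
`e₁₁₁` has negative and `e₁₀₀` positive imaginary part. -/
theorem re_rCoeff_neg (D : N2Datum F P 𝒟) (hfr : IsCMFrame D.τ)
    (h₁₁₁ : IsLiuSignElement K (D.type t111) D.e₁₁₁)
    (h₁₀₀ : IsLiuSignElement K (D.type t100) D.e₁₀₀) (φ : K →+* ℂ)
    (hφ : φ = D.τ 1 ∨ φ = conjugate (D.τ 1)) : (φ (rCoeff D)).re < 0 := by
  have key := im_e₁₀₀_eq D h₁₁₁.1 h₁₀₀.1 h₁₁₁.2.1 (D.τ 1)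
  -- the signs of `Im τ₂(e₁₁₁)` and `Im τ₂(e₁₀₀)`
  have hb : (D.τ 1 D.e₁₁₁).im < 0 :=
    h₁₁₁.2.2 _ ((apply_mem_cubeType_iff hfr t111 1).mpr (by decide))
  have ha' : (conjugate (D.τ 1) D.e₁₀₀).im < 0 :=
    h₁₀₀.2.2 _ ((conjugate_apply_mem_cubeType_iff hfr t100 1).mpr (by decide))
  have ha : 0 < (D.τ 1 D.e₁₀₀).im := by
    rw [im_conjugate] at ha'
    linarith
  -- `a = ρ · b` with `a > 0`, `b < 0` forces `ρ < 0`
  have hρ : (D.τ 1 (rCoeff D)).re < 0 := by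
    by_contra hcon
    have hcon' := not_lt.mp hcon
    nlinarith
  rcases hφ with rfl | rfl
  · exact hρ
  · rw [re_conjugate]
    exact hρ

/-- The index condition of the display at every embedding: `sign φ(1) + sign φ(r) =
sign φ(u) + sign φ(u⁻¹ r)`. -/
theorem index_eq (D : N2Datum F P 𝒟) (hfr : IsCMFrame D.τ)
    (h₁₁₁ : IsLiuSignElement K (D.type t111) D.e₁₁₁)
    (h₁₀₀ : IsLiuSignElement K (D.type t100) D.e₁₀₀) (hu : USpec D) (φ : K →+* ℂ) :
    (SignType.sign (φ (1 : K)).re : ℤ) + SignType.sign (φ (rCoeff D)).re =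
      (SignType.sign (φ D.u).re : ℤ) + SignType.sign (φ (D.u⁻¹ * rCoeff D)).re := by
  have hr := star_rCoeff D h₁₁₁.1 h₁₀₀.1
  have hmul : (φ (D.u⁻¹ * rCoeff D)).re = (φ D.u⁻¹).re * (φ (rCoeff D)).re :=
    re_mul_of_star_eq (T5DatumCMField.star_inv_of_star_eq hu.1) hr φ
  rw [map_one, Complex.one_re, hmul, sign_mul]
  by_cases hneg : (φ D.u).re < 0
  · -- `u < 0` at `φ`, hence `φ ∈ {τ₂, τ̄₂}` and `r < 0` there
    have hrneg := re_rCoeff_neg D hfr h₁₁₁ h₁₀₀ φ ((hu.2.2 φ).mp hneg)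
    have hinv : (φ D.u⁻¹).re < 0 := by
      have h1 := pos_re_inv_iff hu.1 hu.2.1 φ
      have h2 := re_ne_zero_of_star_eq (T5DatumCMField.star_inv_of_star_eq hu.1) (inv_ne_zero hu.2.1) φ
      rcases lt_or_gt_of_ne h2 with h | h
      · exact h
      · exact absurd (h1.mp h) (not_lt.mpr hneg.le)
    rw [sign_neg hrneg, sign_neg hneg, sign_neg hinv]
    simp
  · -- `u > 0` at `φ`
    have hpos : 0 < (φ D.u).re := (pos_re_iff_not_neg hu.1 hu.2.1 φ).mpr hneg
    have hinv : 0 < (φ D.u⁻¹).re := (pos_re_inv_iff hu.1 hu.2.1 φ).mpr hpos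
    rw [sign_pos hpos, sign_pos hinv]
    simp

/-- (b2): `W_B ≅ W_A` — through the displayed classification, applied to the hermitian forms
`W_A / e₁₁₁ = ⟨1, r⟩` and `W_B / e₁₁₁ = ⟨u, u⁻¹ r⟩` (same determinant `r`, same indices). -/
theorem isIsometric_of (D : N2Datum F P 𝒟) (hfr : IsCMFrame D.τ)
    (h₁₁₁ : IsLiuSignElement K (D.type t111) D.e₁₁₁)
    (h₁₀₀ : IsLiuSignElement K (D.type t100) D.e₁₀₀) (hu : USpec D)
    (hSh : Hyp.Shimura2008_Thm2_2_i K) : D.IsIsometric := by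
  have hr := star_rCoeff D h₁₁₁.1 h₁₀₀.1
  have hr0 : rCoeff D ≠ 0 := mul_ne_zero h₁₀₀.2.1 (inv_ne_zero h₁₁₁.2.1)
  have hu0 := hu.2.1
  obtain ⟨g, hg⟩ := hSh 1 (rCoeff D) D.u (D.u⁻¹ * rCoeff D) (star_one K) hr hu.1
    (by rw [star_mul, T5DatumCMField.star_inv_of_star_eq hu.1, hr, mul_comm]) one_ne_zero hr0 hu0
    (mul_ne_zero (inv_ne_zero hu0) hr0)
    ⟨1, one_ne_zero, by simp [hu0]⟩
    (fun φ => index_eq D hfr h₁₁₁ h₁₀₀ hu φ)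
  refine ⟨g, fun v w => ?_⟩
  have hne := h₁₁₁.2.1
  have h3 : D.e₁₁₁ * rCoeff D = D.e₁₀₀ := by
    rw [rCoeff, mul_comm D.e₁₀₀, ← mul_assoc, mul_inv_cancel₀ hne, one_mul]
  have h2 : D.e₁₁₁ * (D.u⁻¹ * rCoeff D) = D.u⁻¹ * D.e₁₀₀ := by
    calc D.e₁₁₁ * (D.u⁻¹ * rCoeff D) = D.u⁻¹ * D.e₁₀₀ * (D.e₁₁₁ * D.e₁₁₁⁻¹) := by
          rw [rCoeff]; ring
      _ = D.u⁻¹ * D.e₁₀₀ := by rw [mul_inv_cancel₀ hne, mul_one]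
  have hA : D.formA v w = pairForm (D.e₁₁₁ * 1) (D.e₁₁₁ * rCoeff D) v w := by
    rw [mul_one, h3]
    rfl
  have hB : D.formB (g v) (g w) =
      pairForm (D.e₁₁₁ * D.u) (D.e₁₁₁ * (D.u⁻¹ * rCoeff D)) (g v) (g w) := by
    rw [h2, mul_comm D.e₁₁₁ D.u]
    rfl
  rw [hA, hB, pairForm_mul_left, pairForm_mul_left, hg v w]

/-! ### Assembly: `Adm`, and the existence form -/

/-- LEMMA N.2 ON THE DATUM: `Adm` for every datum whose frame, generating sign elements and
similitude scalar satisfy their specifications — the display being the only non-kernel input. -/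
theorem adm_of (D : N2Datum F P 𝒟) (hfr : IsCMFrame D.τ)
    (h₁₁₁ : IsLiuSignElement K (D.type t111) D.e₁₁₁)
    (h₁₀₀ : IsLiuSignElement K (D.type t100) D.e₁₀₀) (hu : USpec D)
    (hSh : Hyp.Shimura2008_Thm2_2_i K) : D.Adm :=
  ⟨muAdmissible_of D hfr h₁₁₁ h₁₀₀ hu, isIsometric_of D hfr h₁₁₁ h₁₀₀ hu hSh, hChi D⟩

/-- THE EXPLICIT DATUM of §N2.1(b): from a CM frame, μ-admissible `e₁₁₁`, `e₁₀₀`, splitting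
characters and admissible Schwartz sets, with `u` the similitude scalar of p3's `lemma_N2_datum`. -/
noncomputable def ofSpec (F : FaceSetting K) (P : NDatum F) (𝒟 : N3Datum)
    {τ : Fin 3 → (K →+* ℂ)} (hfr : IsCMFrame τ) {e₁₁₁ e₁₀₀ : K}
    (h₁₁₁ : IsLiuSignElement K (cubeType τ t111) e₁₁₁)
    (h₁₀₀ : IsLiuSignElement K (cubeType τ t100) e₁₀₀)
    (Char : Type) [CommGroup Char] (χ₁₁₁ χ₁₀₀ : Char)
    (admA : Set 𝒟.A.Sa) (admB : Set 𝒟.A.Sb) (admC : Set 𝒟.B.Sa) (admD : Set 𝒟.B.Sb) :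
    N2Datum F P 𝒟 where
  τ := τ
  e₁₁₁ := e₁₁₁
  e₁₀₀ := e₁₀₀
  u := Classical.choose (lemma_N2_datum hfr h₁₁₁ h₁₀₀)
  Char := Char
  χ₁₁₁ := χ₁₁₁
  χ₁₀₀ := χ₁₀₀
  admA := admA
  admB := admB
  admC := admC
  admD := admD

/-- The explicit datum's `u` has the sign specification. -/
theorem ofSpec_uSpec (F : FaceSetting K) (P : NDatum F) (𝒟 : N3Datum)
    {τ : Fin 3 → (K →+* ℂ)} (hfr : IsCMFrame τ) {e₁₁₁ e₁₀₀ : K}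
    (h₁₁₁ : IsLiuSignElement K (cubeType τ t111) e₁₁₁)
    (h₁₀₀ : IsLiuSignElement K (cubeType τ t100) e₁₀₀)
    (Char : Type) [CommGroup Char] (χ₁₁₁ χ₁₀₀ : Char)
    (admA : Set 𝒟.A.Sa) (admB : Set 𝒟.A.Sb) (admC : Set 𝒟.B.Sa) (admD : Set 𝒟.B.Sb) :
    USpec (ofSpec F P 𝒟 hfr h₁₁₁ h₁₀₀ Char χ₁₁₁ χ₁₀₀ admA admB admC admD) := by
  obtain ⟨h1, h2, -, -, -, h6⟩ := Classical.choose_spec (lemma_N2_datum hfr h₁₁₁ h₁₀₀)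
  exact ⟨h1, h2, h6⟩

/-- LEMMA N.2 («the explicit datum meets it», §N2.1(b)): the explicit datum satisfies `Adm`, with
the display as the only non-kernel input. -/
theorem ofSpec_adm (F : FaceSetting K) (P : NDatum F) (𝒟 : N3Datum)
    {τ : Fin 3 → (K →+* ℂ)} (hfr : IsCMFrame τ) {e₁₁₁ e₁₀₀ : K}
    (h₁₁₁ : IsLiuSignElement K (cubeType τ t111) e₁₁₁)
    (h₁₀₀ : IsLiuSignElement K (cubeType τ t100) e₁₀₀)
    (Char : Type) [CommGroup Char] (χ₁₁₁ χ₁₀₀ : Char)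
    (admA : Set 𝒟.A.Sa) (admB : Set 𝒟.A.Sb) (admC : Set 𝒟.B.Sa) (admD : Set 𝒟.B.Sb)
    (hSh : Hyp.Shimura2008_Thm2_2_i K) :
    (ofSpec F P 𝒟 hfr h₁₁₁ h₁₀₀ Char χ₁₁₁ χ₁₀₀ admA admB admC admD).Adm :=
  adm_of _ hfr h₁₁₁ h₁₀₀ (ofSpec_uSpec F P 𝒟 hfr h₁₁₁ h₁₀₀ Char χ₁₁₁ χ₁₀₀ admA admB admC admD) hSh

end Summit.Ventures.HodgeRepro2.T6.N2Main
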